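import Literature.MathematicalPhysics.QuantumFieldTheory.Balaban1983to89.B13Eq240TreeGraph

/-!
# `Balaban1983to89.B13Eq240Printed` — the displays (2.39), (2.40), (2.41) of T. Bałaban, *Renormalization group
approach to lattice gauge field theories. II. Cluster expansions*, Commun. Math. Phys. **116**, 1–22 (1988),
doi:10.1007/bf01239022 [Balaban1988RG2Cluster] (cell paper B13), p. 21, IN THE PRINTED LETTERS, proved by the
printed route *"repeat all the considerations and bounds of the paper [26]"* ([26] = C. Cammarota, Commun. Math.
Phys. **85** (1982) 517–528, §3) — the engine is the sibling `B13Eq240TreeGraph`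

statement-level skeleton of published theorems with citation tags; proofs where landed; nothing here is a claim about the Yang–Mills mass gap

PDF held: `paper:balaban1988-cmp116-rg-ii-cluster` (journal page = PDF page; pp. 20–21 read this session with
`lit read … --pages 20-21`) and `paper:doi-10-1007-bf01403502` (= [26], pp. 517–528, read this session).

WHAT IS REPRODUCED = SKELETON row **B13.Eq2.40** (with the sentences around it: (2.39) and (2.41)), unit
`lit-balaban-p24` (Phase-2 proof seat p24, gen 2; HOME `run/shared/lean/pub/lit-balaban/`).  The passage, p. 20 last
paragraph – p. 21 [PDF 20–21], verbatim: *"The series (2.13), defining E^{(k+1)}(X), is estimated in the standard way,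
each factor |H(Z)| is replaced by the right-hand side of (2.38) in the bound. Consider a term in the sum. We have a
product of n exponentials from (2.38). We extract the exponential exp(−δ½Lκd_{k+1}(Z_i)) from the i-th factor, and the
remaining product is estimated using (2.27), and the condition ∪Z_i = X, X is a connected domain. This yields*
  `|E^{(k+1)}(X)| ≤ exp(−(1 − 9δ)½Lκd_{k+1}(X)) exp(−5κ)
     · Σ_{n=1}^∞ (1/n!) Σ_{(Z₁,…,Z_n): ∪Z_i = X} |ρ^T(Z₁,…,Z_n)| Π_{i=1}^n C₃ε₁ exp 5κ exp(−δ½Lκd_{k+1}(Z_i)).`  (2.39)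
*To the above sum we can repeat all the considerations and bounds of the paper [26], for κ sufficiently large, and ε₁
sufficiently small. We obtain*
  `|E^{(k+1)}(X)| ≤ exp(−(1 − 9δ)½Lκd_{k+1}(X)) exp(−5κ)
     · Σ_{Z⊂X} C₃ε₁ exp 5κ exp(−½δLκd_{k+1}(Z)) O(1) exp 2(LM)⁻⁴|Z|.`                                 (2.40)
*The last sum is bounded by C₃ε₁ exp 5κ O(1)(LM)⁻⁴|X| ≤ C₃ε₁ exp 5κ O(1) exp(LM)⁻⁴|X|, and the last exponential
multiplied by exp(−½δLκd_{k+1}(X)) is bounded by 1. This yields*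
  `|E^{(k+1)}(X)| ≤ O(1)C₃ε₁ exp(−(1 − 10δ)½Lκd_{k+1}(X)).`                                          (2.41)

SETTING (as in `B13FamilySum` / `B13Resummation` / `B13UrsellKPSeries` / `B13Eq240TreeGraph`): a finite type `P` of
polymers (𝐃_{k+1} at finite volume), footprints `cubes : P → Finset Cube` (the LM-cubes; `|Z|` := `#cubes Z` =
`(LM)⁻⁴|Z|` in `d = 4`), tree lengths `d` (= `d_{k+1}`), a symmetric `{0,1}`-valued two-body function `ζ`,
footprint-local through `reach`/`ν` (*"ζ(Z, Z′) = 0 if Z ∩ Z′ contains a cube, or a wall of a cube"* (2.11):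
`ζ(Z′, Z) = 0` forces `Z′` to contain a cube of `reach Z`, `#reach Z ≤ ν|Z|`); the by-reference inputs of the
passage enter as the hypotheses the tree already names: (1.26) at scale `k + 1` = `B13FamilySum.Ineq126` (rate `κ₀`,
constant `K₀`), the volume bound (2.30) in its ADDITIVE form `|Z| ≤ c₁(1 + d(Z))` = `B13FamilySum.VolBound`, (2.27)
= `B13FamilySum.Ineq227` (constant `c`, print `5`).  The weights of (2.39) are `w239 d A b r`:
`w(Z) = A e^{b} e^{−r d(Z)}` — print `A = C₃ε₁`, `e^{b} = "exp 5κ"`, `r = δ½Lκ`.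

WHAT IS PROVED (0 sorry):
* THE PRINTED DISPLAYS for the weights of (2.39) `w239 Z = A e^{b} e^{−r d(Z)}` (print: `A = C₃ε₁`, `b = 5κ`,
  `r = δ½Lκ`): **`ineq240`** = (2.40) with `O(1) = 2`, "κ sufficiently large" := `κ₀ + 2c₁ ≤ r`, "ε₁ sufficiently
  small" := `8ν K₀ e^{b + c₁} A ≤ 1` ((1.26) at rate κ₀ with constant K₀, (2.30) additive `|Z| ≤ c₁(1 + d(Z))`);
  `sum240_le_card` (*"The last sum is bounded by C₃ε₁ exp 5κ O(1)(LM)⁻⁴|X|"*), `card_le_exp` (*"≤ … exp(LM)⁻⁴|X|"*),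
  `exp_card_mul_exp_neg_le` (*"the last exponential multiplied by exp(−½δLκd_{k+1}(X)) is bounded by 1"* — by
  `e^{c₁}` under the ADDITIVE (2.30); the printed "1" uses the multiplicative (2.30), false as printed, cell GAPS.md
  G-B13-07), **`ineq241_of_239`** ((2.39)-right side ≤ `2K₀e^{3c₁} · A · e^{−r₁ d_{k+1}(X)}` = (2.41) with
  `O(1) = 2K₀e^{3c₁}`), and **`ineq239`** ((2.39) itself: `|Σ (2.13)| ≤` its right side, from an activity bound
  `|H(Z)| ≤ A e^{−(r₁+2r) d(Z)}` (= (2.38): `r₁ + 2r = (1 − 8δ)½Lκ`) and (2.27) with constant `c`, merging exponent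
  `b = c(r₁ + r)`; print `c = 5`, `b = "5κ"` — under the closing condition `(1 − 10δ)½L = 1` the honest exponent is
  `5(κ + δ½Lκ)`, the located understatement recorded in SKELETON row B13.Eq2.39's transcript note; the step does not
  depend on the value of `b`).
* `norm_ursellSeries213_le` — the three displays chained: (2.38)-type activity bound ⇒ (2.41) for the PRINTED series
  (2.13) `B13MayerDecoupling.ursellSeries213`, by the [26]-route.
* §5 `summable_ursellAbsTermIn_of_small` — p. 20 *"sufficient conditions for convergence of the series (2.12), (2.13)
  are satisfied, see [26, …]"* made quantitative: absolute convergence of (2.12) over the polymers inside `X` WITH THE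
  MARGIN `3/2` under `κ₀ + c₁ ≤ R`, `8ν A e^{c₁} K₀ ≤ 1`; hence `ursellSeries213_eq_locE_of_small`: the printed (2.13)
  EQUALS the tree's Kotecký–Preiss object `B13Resummation.locE` (the gen-1 Mayer identity
  `B13UrsellKPSeries.ursellSeries213_eq_locE` with its convergence hypothesis discharged).
* §6 the bridge to `B13.lean`: `norm_ursellSeries213_le_step` ((2.41)_ℓ for the printed series on the abstract
  `StepData` + `B13Resummation.Geometry`), **`cammarotaStepWith_of_treeGraph`** / `cammarotaStep_of_treeGraph`
  (`B13.CammarotaStepWith S c ℓ` / `B13.CammarotaStep S c` from the PRINTED representation (2.13)), and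
  **`cammarotaStepWith_of_treeGraph_locE`** (the same from the KP representation `B13Resummation.Repr213`) — the
  [26]-route twin of `B13Resummation.cammarotaStepWith_of_KP` (cell GAPS.md G-B13-11), with
  "κ sufficiently large" := `κ₀ + 2c₁ ≤ δℓκ`, "ε₁ sufficiently small" := `8ν C₃ε₁ e^{5(1−9δ)ℓκ} e^{c₁} K₀ ≤ 1`,
  `A₂ ≥ 2K₀e^{3c₁}`.
Relation to the tree: the KP certificate `B13Resummation.norm_locE_le_of_small` (Kotecký–Preiss, anchored at ONE cube,
no `|X|`, largeness only in `κ₀`) remains the kernel route of record for (2.41); this file is the [26]-route the paper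
prints, with its `|X|` and its second `δ`.  No new hypothesis structure is introduced (the printed representation
enters `cammarotaStepWith_of_treeGraph` as an explicit binder).

v1.1 (same unit, APPEND-ONLY; every v1 declaration byte-identical): + §7 — the [26]-route in the printed letters under the
closing condition `(1 − 10δ)ℓ = 1` of p. 21 (`cammarotaStepWith_of_treeGraph_R22gen`: "κ sufficiently large" :=
`κ₀ + 2c₁ ≤ δℓκ`, "ε₁ sufficiently small" := `8ν C₃ε₁ e^{5(κ + δℓκ)} e^{c₁} K₀ ≤ 1`), and the §2 chain of `B13.lean`
with the [26]-hypothesis replaced by this discharge: `bound118_of_treeGraph` ((I.1.18) with ½E₀ from (2.38)_ℓ, p. 21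
*"The inequality (2.41) and the assumptions imply the inequality (I.1.18), with ½E₀ instead of E₀"*) and
`deliverables_of_chainWith_treeGraph` (the delivered clauses for A_{k+1}) — the [26]-route twins of
`B13Resummation.bound118_of_KP` / `deliverables_of_chainWith_KP`.
-/

open Finset

noncomputable section

namespace Literature.MathematicalPhysics.QuantumFieldTheory.Balaban1983to89.B13Eq240Printed

open Literature.MathematicalPhysics.QuantumFieldTheory.Balaban1983to89.B13MayerDecoupling (rhoT ursellSeries213)
open Literature.MathematicalPhysics.QuantumFieldTheory.Balaban1983to89.B13FamilySum (inside mem_inside Ineq126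
  VolBound Ineq227 coveringFamilies mem_coveringFamilies sum_inside_le_card_mul)
open Literature.MathematicalPhysics.QuantumFieldTheory.Balaban1983to89.B13Eq240TreeGraph (absTerm213 absSeries213
  absSeries213_le summable_absTerm213 sum_inside_succ_div_le)
open Literature.MathematicalPhysics.QuantumFieldTheory.Balaban1983to89.B13UrsellKPSeries (zetaOf zetaOf_01 zetaOf_symm
  zetaOf_eq_zero_iff ursellAbsTermIn ursellSeries213_eq_locE)

variable {P : Type*} {ζ : P → P → ℝ}

/-! ## §4 The printed displays: (2.40), the sentence after it, (2.41), and (2.39) itself -/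

section Printed

variable [Fintype P] {Cube : Type*} [DecidableEq Cube]

/-- The weights of (2.39) p. 21: `w(Z) = A · e^{b} · e^{−r d_{k+1}(Z)}` — print `A = C₃ε₁`, `e^{b} = "exp 5κ"` (the
merging cost paid per factor when (2.27) is used), `r = δ½Lκ` (the extracted rate). [cite: Balaban1988RG2Cluster, (2.39) p.21] -/
def w239 (d : P → ℝ) (A b r : ℝ) (Z : P) : ℝ := A * Real.exp b * Real.exp (-(r * d Z))

omit [Fintype P] in
/-- `w239 ≥ 0` for `A ≥ 0`. [cite: Balaban1988RG2Cluster, (2.39) p.21] (elementary API for (2.39)) -/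
theorem w239_nonneg {d : P → ℝ} {A : ℝ} (hA : 0 ≤ A) (b r : ℝ) (Z : P) : 0 ≤ w239 d A b r Z :=
  mul_nonneg (mul_nonneg hA (Real.exp_nonneg _)) (Real.exp_nonneg _)

variable {cubes reach : P → Finset Cube} {d : P → ℝ} {ν κ₀ K₀ c₁ : ℝ}

/-- THE ANCHORED EXPONENTIAL NORM OF THE (2.39)-WEIGHTS from (1.26) and (2.30): if `κ₀ + m·c₁ ≤ r` ("κ sufficiently
large") then `Σ_{Z∈S: q∈Z} w(Z)·e^{m|Z|} ≤ A e^{b} e^{m c₁} K₀` for every cube `q` — by `|Z| ≤ c₁(1 + d(Z))`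
((2.30), additive form) and `Σ_{Z∋q} e^{−κ₀ d(Z)} ≤ K₀` ((1.26)). [cite: Balaban1988RG2Cluster, (2.40) p.21] -/
theorem anchored_w239 {A b r m : ℝ} (S : Finset P) (hd : ∀ Z, 0 ≤ d Z) (hA : 0 ≤ A) (hm : 0 ≤ m)
    (h126 : Ineq126 (Finset.univ : Finset P) cubes d κ₀ K₀) (hvol : VolBound (Finset.univ : Finset P) cubes d c₁)
    (hlarge : κ₀ + m * c₁ ≤ r) (q : Cube) :
    ∑ Z ∈ S with q ∈ cubes Z, w239 d A b r Z * Real.exp (m * ((cubes Z).card : ℝ)) ≤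
      A * Real.exp b * Real.exp (m * c₁) * K₀ := by
  have hpt : ∀ Z, w239 d A b r Z * Real.exp (m * ((cubes Z).card : ℝ)) ≤
      A * Real.exp b * Real.exp (m * c₁) * Real.exp (-(κ₀ * d Z)) := by
    intro Z
    have hv : ((cubes Z).card : ℝ) ≤ c₁ * (1 + d Z) := hvol Z (Finset.mem_univ Z)
    have hexp : Real.exp (-(r * d Z)) * Real.exp (m * ((cubes Z).card : ℝ)) ≤
        Real.exp (m * c₁) * Real.exp (-(κ₀ * d Z)) := by
      rw [← Real.exp_add, ← Real.exp_add]
      refine Real.exp_le_exp.2 ?_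
      have h1 : m * ((cubes Z).card : ℝ) ≤ m * (c₁ * (1 + d Z)) := mul_le_mul_of_nonneg_left hv hm
      have h2 : (κ₀ + m * c₁) * d Z ≤ r * d Z := mul_le_mul_of_nonneg_right hlarge (hd Z)
      nlinarith
    calc w239 d A b r Z * Real.exp (m * ((cubes Z).card : ℝ))
        = A * Real.exp b * (Real.exp (-(r * d Z)) * Real.exp (m * ((cubes Z).card : ℝ))) := by
          unfold w239; ring
      _ ≤ A * Real.exp b * (Real.exp (m * c₁) * Real.exp (-(κ₀ * d Z))) :=
          mul_le_mul_of_nonneg_left hexp (mul_nonneg hA (Real.exp_nonneg _))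
      _ = A * Real.exp b * Real.exp (m * c₁) * Real.exp (-(κ₀ * d Z)) := by ring
  calc ∑ Z ∈ S with q ∈ cubes Z, w239 d A b r Z * Real.exp (m * ((cubes Z).card : ℝ))
      ≤ ∑ Z ∈ (Finset.univ : Finset P) with q ∈ cubes Z, w239 d A b r Z * Real.exp (m * ((cubes Z).card : ℝ)) :=
        Finset.sum_le_sum_of_subset_of_nonneg
          (Finset.filter_subset_filter _ (Finset.subset_univ S))
          (fun Z _ _ => mul_nonneg (w239_nonneg hA b r Z) (Real.exp_nonneg _))
    _ ≤ ∑ Z ∈ (Finset.univ : Finset P) with q ∈ cubes Z,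
          A * Real.exp b * Real.exp (m * c₁) * Real.exp (-(κ₀ * d Z)) := Finset.sum_le_sum fun Z _ => hpt Z
    _ = A * Real.exp b * Real.exp (m * c₁) *
          ∑ Z ∈ (Finset.univ : Finset P) with q ∈ cubes Z, Real.exp (-(κ₀ * d Z)) := by rw [Finset.mul_sum]
    _ ≤ A * Real.exp b * Real.exp (m * c₁) * K₀ :=
        mul_le_mul_of_nonneg_left (h126 q) (mul_nonneg (mul_nonneg hA (Real.exp_nonneg _)) (Real.exp_nonneg _))

/-- **(2.40) AS PRINTED** (p. 21): *"To the above sum we can repeat all the considerations and bounds of the paper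
[26], for κ sufficiently large, and ε₁ sufficiently small. We obtain |E^{(k+1)}(X)| ≤ exp(−(1 − 9δ)½Lκd_{k+1}(X))
exp(−5κ) Σ_{Z⊂X} C₃ε₁ exp 5κ exp(−½δLκd_{k+1}(Z)) O(1) exp 2(LM)⁻⁴|Z|"* — the series of (2.39) is bounded by the
sum over the single polymers `Z ⊂ X` of the (2.39)-weight times `O(1)·e^{2|Z|}` (`|Z|` = number of LM-cubes of `Z` =
`(LM)⁻⁴|Z|` in `d = 4`), with `O(1) = 2`, "κ sufficiently large" := `κ₀ + c₁ ≤ r` and "ε₁ sufficiently small" :=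
`8ν·A e^{b} e^{c₁} K₀ ≤ 1` (by [26]'s method: §1–§3; the common prefactor `exp(−(1 − 9δ)½Lκd_{k+1}(X)) exp(−5κ)`
of (2.39)/(2.40) is untouched). [cite: Balaban1988RG2Cluster, (2.40) p.21] -/
theorem ineq240 (h01 : ∀ Z Z', ζ Z Z' = 0 ∨ ζ Z Z' = 1) (hsymm : ∀ Z Z', ζ Z Z' = ζ Z' Z)
    (hloc : ∀ Z Z', ζ Z' Z = 0 → ∃ q ∈ reach Z, q ∈ cubes Z')
    (hreach : ∀ Z, ((reach Z).card : ℝ) ≤ ν * (cubes Z).card) (hν : 0 ≤ ν) (hd : ∀ Z, 0 ≤ d Z) {A b r : ℝ}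
    (hA : 0 ≤ A) (hK₀ : 0 ≤ K₀)
    (h126 : Ineq126 (Finset.univ : Finset P) cubes d κ₀ K₀) (hvol : VolBound (Finset.univ : Finset P) cubes d c₁)
    (hlarge : κ₀ + c₁ ≤ r) (hsmall : 8 * ν * (A * Real.exp b * Real.exp c₁ * K₀) ≤ 1) (X : Finset Cube) :
    absSeries213 ζ (w239 d A b r) cubes X ≤
      ∑ Z ∈ inside (Finset.univ : Finset P) cubes X,
        w239 d A b r Z * (2 * Real.exp (2 * ((cubes Z).card : ℝ))) := by
  have hΦ : 0 ≤ A * Real.exp b * Real.exp c₁ * K₀ :=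
    mul_nonneg (mul_nonneg (mul_nonneg hA (Real.exp_nonneg _)) (Real.exp_nonneg _)) hK₀
  have hanch : ∀ q : Cube, ∑ Z ∈ inside (Finset.univ : Finset P) cubes X with q ∈ cubes Z,
      w239 d A b r Z * Real.exp ((cubes Z).card : ℝ) ≤ A * Real.exp b * Real.exp c₁ * K₀ := by
    intro q
    have h := anchored_w239 (b := b) (m := 1) (inside (Finset.univ : Finset P) cubes X) hd hA zero_le_one h126 hvol
      (by simpa using hlarge) q
    simpa only [one_mul] using h
  have h := absSeries213_le h01 hsymm (w239_nonneg hA b r) hΦ hν hanch hloc hreach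
    (by simpa [mul_assoc] using hsmall) (X := X)
  refine h.trans ?_
  rw [Finset.mul_sum]
  refine Finset.sum_le_sum fun Z _ => ?_
  have hw := w239_nonneg (d := d) hA b r Z
  have he : Real.exp ((cubes Z).card : ℝ) ≤ Real.exp (2 * ((cubes Z).card : ℝ)) :=
    Real.exp_le_exp.2 (by linarith [Nat.cast_nonneg (α := ℝ) (cubes Z).card])
  calc 2 * (w239 d A b r Z * Real.exp ((cubes Z).card : ℝ))
      ≤ 2 * (w239 d A b r Z * Real.exp (2 * ((cubes Z).card : ℝ))) := by gcongr
    _ = w239 d A b r Z * (2 * Real.exp (2 * ((cubes Z).card : ℝ))) := by ring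

/-- p. 21, the sentence after (2.40), first half, verbatim: *"The last sum is bounded by C₃ε₁ exp 5κ O(1)(LM)⁻⁴|X|"* —
every polymer `Z ⊂ X` contains one of the `|X|` cubes of `X` and the anchored sums are bounded through (1.26)/(2.30)
(`anchored_w239` with `m = 2`: "κ sufficiently large" := `κ₀ + 2c₁ ≤ r`); the printed `O(1)` here is `2e^{2c₁}K₀`.
[cite: Balaban1988RG2Cluster, (2.40)–(2.41) p.21] -/
theorem sum240_le_card (hne : ∀ Z : P, (cubes Z).Nonempty) (hd : ∀ Z, 0 ≤ d Z) {A b r : ℝ} (hA : 0 ≤ A)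
    (h126 : Ineq126 (Finset.univ : Finset P) cubes d κ₀ K₀) (hvol : VolBound (Finset.univ : Finset P) cubes d c₁)
    (hlarge : κ₀ + 2 * c₁ ≤ r) (X : Finset Cube) :
    ∑ Z ∈ inside (Finset.univ : Finset P) cubes X, w239 d A b r Z * (2 * Real.exp (2 * ((cubes Z).card : ℝ))) ≤
      (X.card : ℝ) * (2 * (A * Real.exp b * Real.exp (2 * c₁) * K₀)) := by
  refine sum_inside_le_card_mul (Finset.univ : Finset P) cubes X
    (fun Z => w239 d A b r Z * (2 * Real.exp (2 * ((cubes Z).card : ℝ)))) _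
    (fun Z _ => mul_nonneg (w239_nonneg hA b r Z) (by positivity)) (fun Z _ => hne Z) fun q _ => ?_
  have h := anchored_w239 (b := b) (m := 2) (Finset.univ : Finset P) hd hA (by norm_num) h126 hvol hlarge q
  calc ∑ Z ∈ (Finset.univ : Finset P) with q ∈ cubes Z, w239 d A b r Z * (2 * Real.exp (2 * ((cubes Z).card : ℝ)))
      = 2 * ∑ Z ∈ (Finset.univ : Finset P) with q ∈ cubes Z,
          w239 d A b r Z * Real.exp (2 * ((cubes Z).card : ℝ)) := by
        rw [Finset.mul_sum]
        exact Finset.sum_congr rfl fun Z _ => by ring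
    _ ≤ 2 * (A * Real.exp b * Real.exp (2 * c₁) * K₀) := by gcongr

omit [DecidableEq Cube] in
/-- p. 21, the sentence after (2.40), middle, verbatim: *"C₃ε₁ exp 5κ O(1)(LM)⁻⁴|X| ≤ C₃ε₁ exp 5κ O(1) exp(LM)⁻⁴|X|"*
— the volume is bounded by its exponential. [cite: Balaban1988RG2Cluster, (2.40)–(2.41) p.21] -/
theorem card_le_exp (X : Finset Cube) : (X.card : ℝ) ≤ Real.exp (X.card : ℝ) := by
  linarith [Real.add_one_le_exp (X.card : ℝ)]

omit [DecidableEq Cube] in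
/-- p. 21, the sentence after (2.40), end, verbatim: *"and the last exponential multiplied by exp(−½δLκd_{k+1}(X)) is
bounded by 1"* — with the ADDITIVE volume bound `|X| ≤ c₁(1 + d_{k+1}(X))` of (2.30) (the form that holds; the
multiplicative printed (2.30) is false for degenerate domains, cell GAPS.md G-B13-07) the product is bounded by
`e^{c₁}` (not `1`) as soon as `c₁ ≤ r` ("κ sufficiently large"). [cite: Balaban1988RG2Cluster, (2.40)–(2.41) p.21] -/
theorem exp_card_mul_exp_neg_le {X : Finset Cube} {dX r : ℝ} (hXvol : (X.card : ℝ) ≤ c₁ * (1 + dX))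
    (hdX : 0 ≤ dX) (hr : c₁ ≤ r) :
    Real.exp (X.card : ℝ) * Real.exp (-(r * dX)) ≤ Real.exp c₁ := by
  rw [← Real.exp_add]
  refine Real.exp_le_exp.2 ?_
  nlinarith

/-- **(2.39) ⇒ (2.41)** (p. 21): the right-hand side of (2.39),
`exp(−(1 − 9δ)½Lκd_{k+1}(X)) exp(−b) · Σ_n (1/n!) Σ_{∪Z_i = X} |ρ^T| Π_i A e^{b} exp(−δ½Lκd_{k+1}(Z_i))`
(rates: `(1 − 9δ)½Lκ = r₁ + r` with `r₁ = (1 − 10δ)½Lκ`, `r = δ½Lκ`), is at most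
`O(1) · A · exp(−r₁ d_{k+1}(X))` = the right-hand side of (2.41) *"|E^{(k+1)}(X)| ≤ O(1)C₃ε₁
exp(−(1 − 10δ)½Lκd_{k+1}(X))"*, with `O(1) = 2K₀e^{3c₁}`, under "κ sufficiently large" := `κ₀ + 2c₁ ≤ r` and
"ε₁ sufficiently small" := `8ν A e^{b} e^{c₁} K₀ ≤ 1` — by (2.40) (`ineq240`), `sum240_le_card`, `card_le_exp` and
`exp_card_mul_exp_neg_le` (the second `δ` absorbs `e^{|X|}`). [cite: Balaban1988RG2Cluster, (2.41) p.21] -/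
theorem ineq241_of_239 (h01 : ∀ Z Z', ζ Z Z' = 0 ∨ ζ Z Z' = 1) (hsymm : ∀ Z Z', ζ Z Z' = ζ Z' Z)
    (hloc : ∀ Z Z', ζ Z' Z = 0 → ∃ q ∈ reach Z, q ∈ cubes Z')
    (hreach : ∀ Z, ((reach Z).card : ℝ) ≤ ν * (cubes Z).card) (hν : 0 ≤ ν) (hne : ∀ Z : P, (cubes Z).Nonempty)
    (hd : ∀ Z, 0 ≤ d Z) {A b r r₁ dX : ℝ} {X : Finset Cube} (hA : 0 ≤ A) (hK₀ : 0 ≤ K₀) (hκ₀ : 0 ≤ κ₀)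
    (hc₁ : 0 ≤ c₁)
    (h126 : Ineq126 (Finset.univ : Finset P) cubes d κ₀ K₀) (hvol : VolBound (Finset.univ : Finset P) cubes d c₁)
    (hXvol : (X.card : ℝ) ≤ c₁ * (1 + dX)) (hdX : 0 ≤ dX)
    (hlarge : κ₀ + 2 * c₁ ≤ r) (hsmall : 8 * ν * (A * Real.exp b * Real.exp c₁ * K₀) ≤ 1) :
    Real.exp (-((r₁ + r) * dX)) * Real.exp (-b) * absSeries213 ζ (w239 d A b r) cubes X ≤
      2 * K₀ * Real.exp (3 * c₁) * A * Real.exp (-(r₁ * dX)) := by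
  have hlarge1 : κ₀ + c₁ ≤ r := by linarith
  have hlarge0 : c₁ ≤ r := by linarith
  have h240 := ineq240 h01 hsymm hloc hreach hν hd hA hK₀ h126 hvol hlarge1 hsmall X (b := b)
  have hcard := sum240_le_card hne hd hA h126 hvol hlarge X (b := b)
  have hexp := card_le_exp X
  have habs := exp_card_mul_exp_neg_le hXvol hdX hlarge0
  have hC : 0 ≤ 2 * (A * Real.exp b * Real.exp (2 * c₁) * K₀) := by positivity
  have hpref : 0 ≤ Real.exp (-((r₁ + r) * dX)) * Real.exp (-b) := by positivity
  -- the chain (2.40) → |X| → e^{|X|}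
  have hseries : absSeries213 ζ (w239 d A b r) cubes X ≤
      Real.exp (X.card : ℝ) * (2 * (A * Real.exp b * Real.exp (2 * c₁) * K₀)) :=
    (h240.trans hcard).trans (mul_le_mul_of_nonneg_right hexp hC)
  -- bookkeeping of the exponentials
  have hsplit : Real.exp (-((r₁ + r) * dX)) * Real.exp (-b) *
      (Real.exp (X.card : ℝ) * (2 * (A * Real.exp b * Real.exp (2 * c₁) * K₀))) =
      (Real.exp (X.card : ℝ) * Real.exp (-(r * dX))) *
        (2 * K₀ * Real.exp (2 * c₁) * A * Real.exp (-(r₁ * dX))) * (Real.exp (-b) * Real.exp b) := by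
    have h1 : Real.exp (-((r₁ + r) * dX)) = Real.exp (-(r₁ * dX)) * Real.exp (-(r * dX)) := by
      rw [← Real.exp_add]; congr 1; ring
    rw [h1]; ring
  have hbb : Real.exp (-b) * Real.exp b = 1 := by rw [← Real.exp_add]; simp
  calc Real.exp (-((r₁ + r) * dX)) * Real.exp (-b) * absSeries213 ζ (w239 d A b r) cubes X
      ≤ Real.exp (-((r₁ + r) * dX)) * Real.exp (-b) *
          (Real.exp (X.card : ℝ) * (2 * (A * Real.exp b * Real.exp (2 * c₁) * K₀))) :=
        mul_le_mul_of_nonneg_left hseries hpref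
    _ = (Real.exp (X.card : ℝ) * Real.exp (-(r * dX))) *
          (2 * K₀ * Real.exp (2 * c₁) * A * Real.exp (-(r₁ * dX))) := by rw [hsplit, hbb, mul_one]
    _ ≤ Real.exp c₁ * (2 * K₀ * Real.exp (2 * c₁) * A * Real.exp (-(r₁ * dX))) :=
        mul_le_mul_of_nonneg_right habs (by positivity)
    _ = 2 * K₀ * (Real.exp c₁ * Real.exp (2 * c₁)) * A * Real.exp (-(r₁ * dX)) := by ring
    _ = 2 * K₀ * Real.exp (3 * c₁) * A * Real.exp (-(r₁ * dX)) := by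
        rw [← Real.exp_add]; congr 3; ring

/-- The product of the activity bounds along a sequence with `∪Z_i = X`, split as the paper says (p. 20–21: *"We have
a product of n exponentials from (2.38). We extract the exponential exp(−δ½Lκd_{k+1}(Z_i)) from the i-th factor, and
the remaining product is estimated using (2.27), and the condition ∪Z_i = X"*): with `|H(Z)| ≤ A e^{−(r₁+2r)d(Z)}`
on the polymers inside `X` and (2.27) with constant `c` for the covering families of `X`,
`Π_i |H(Z_i)| ≤ e^{−(r₁+r)d(X)} e^{−b} Π_i (A e^{b} e^{−r d(Z_i)})`, `b = c(r₁ + r)`.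
[cite: Balaban1988RG2Cluster, (2.39) p.21] -/
theorem prod_norm_le_of_covering {H : P → ℂ} {A r₁ r b c dX : ℝ} {X : Finset Cube} (hA : 0 ≤ A)
    (hr : 0 ≤ r₁ + r) (hc : 0 ≤ c) (hb : b = c * (r₁ + r)) (hd : ∀ Z, 0 ≤ d Z)
    (hH : ∀ Z, cubes Z ⊆ X → ‖H Z‖ ≤ A * Real.exp (-((r₁ + 2 * r) * d Z)))
    (h227 : Ineq227 (Finset.univ : Finset P) cubes d X dX c) {n : ℕ} {Z : Fin n → P}
    (hZ : (Finset.univ : Finset (Fin n)).biUnion (fun i => cubes (Z i)) = X) :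
    ∏ i, ‖H (Z i)‖ ≤ Real.exp (-((r₁ + r) * dX)) * Real.exp (-b) * ∏ i, w239 d A b r (Z i) := by
  classical
  set S : ℝ := ∑ i, d (Z i) with hS
  -- (2.27) for the covering family `{Z_i}` and `d ≥ 0`: `dX + c ≤ S + n c`
  have hsub : ∀ i, cubes (Z i) ⊆ X := fun i => by
    rw [← hZ]; exact Finset.subset_biUnion_of_mem (fun i => cubes (Z i)) (Finset.mem_univ i)
  have hD : Finset.univ.image Z ∈ coveringFamilies (Finset.univ : Finset P) cubes X := by
    rw [mem_coveringFamilies]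
    refine ⟨Finset.subset_univ _, ?_⟩
    rw [Finset.image_biUnion]
    exact hZ
  have h227' : dX + c ≤ S + n * c := by
    have h1 := h227 _ hD
    have h2 : ∑ Y ∈ Finset.univ.image Z, (d Y + c) ≤ ∑ i : Fin n, (d (Z i) + c) :=
      Finset.sum_image_le_of_nonneg fun i _ => add_nonneg (hd _) hc
    have h3 : ∑ i : Fin n, (d (Z i) + c) = S + n * c := by
      rw [Finset.sum_add_distrib, Finset.sum_const, Finset.card_univ, Fintype.card_fin, nsmul_eq_mul, hS]
    linarith
  -- the two products as `A^n · exp(…)`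
  have hlhs : ∏ i, (A * Real.exp (-((r₁ + 2 * r) * d (Z i)))) = A ^ n * Real.exp (-((r₁ + 2 * r) * S)) := by
    rw [Finset.prod_mul_distrib, Finset.prod_const, Finset.card_univ, Fintype.card_fin, ← Real.exp_sum]
    congr 1
    rw [hS, Finset.mul_sum, ← Finset.sum_neg_distrib]
  have hrhs : Real.exp (-((r₁ + r) * dX)) * Real.exp (-b) * ∏ i, w239 d A b r (Z i) =
      A ^ n * (Real.exp (-((r₁ + r) * dX)) * Real.exp (-b) * Real.exp b ^ n * Real.exp (-(r * S))) := by
    unfold w239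
    rw [Finset.prod_mul_distrib, Finset.prod_mul_distrib, Finset.prod_const, Finset.prod_const, Finset.card_univ,
      Fintype.card_fin, ← Real.exp_sum]
    have : ∑ i, -(r * d (Z i)) = -(r * S) := by rw [hS, Finset.mul_sum, ← Finset.sum_neg_distrib]
    rw [this]; ring
  have hkey : Real.exp (-((r₁ + 2 * r) * S)) ≤
      Real.exp (-((r₁ + r) * dX)) * Real.exp (-b) * Real.exp b ^ n * Real.exp (-(r * S)) := by
    rw [← Real.exp_nat_mul, ← Real.exp_add, ← Real.exp_add, ← Real.exp_add]
    refine Real.exp_le_exp.2 ?_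
    have hm : (r₁ + r) * (dX + c) ≤ (r₁ + r) * (S + n * c) := mul_le_mul_of_nonneg_left h227' hr
    subst hb
    nlinarith
  calc ∏ i, ‖H (Z i)‖ ≤ ∏ i, (A * Real.exp (-((r₁ + 2 * r) * d (Z i)))) :=
        Finset.prod_le_prod (fun i _ => norm_nonneg _) fun i _ => hH _ (hsub i)
    _ = A ^ n * Real.exp (-((r₁ + 2 * r) * S)) := hlhs
    _ ≤ A ^ n * (Real.exp (-((r₁ + r) * dX)) * Real.exp (-b) * Real.exp b ^ n * Real.exp (-(r * S))) :=
        mul_le_mul_of_nonneg_left hkey (pow_nonneg hA n)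
    _ = Real.exp (-((r₁ + r) * dX)) * Real.exp (-b) * ∏ i, w239 d A b r (Z i) := hrhs.symm

/-- **(2.39) AS PRINTED** (p. 20–21): *"The series (2.13), defining E^{(k+1)}(X), is estimated in the standard way,
each factor |H(Z)| is replaced by the right-hand side of (2.38) in the bound. … This yields |E^{(k+1)}(X)| ≤
exp(−(1 − 9δ)½Lκd_{k+1}(X)) exp(−5κ) Σ_{n=1}^∞ (1/n!) Σ_{(Z₁,…,Z_n): ∪Z_i = X} |ρ^T(Z₁,…,Z_n)| Π_{i=1}^n C₃ε₁ exp 5κ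
exp(−δ½Lκd_{k+1}(Z_i))"* — for the PRINTED series (2.13) (`B13MayerDecoupling.ursellSeries213`) of activities with
`|H(Z)| ≤ A e^{−(r₁+2r)d_{k+1}(Z)}` on `Z ⊂ X` ((2.38): `A = C₃ε₁`, `r₁ + 2r = (1 − 8δ)½Lκ`, `r = δ½Lκ`) and (2.27)
with constant `c` (print `5`), merging exponent `b = c(r₁ + r)` (print *"5κ"*: under the closing condition
`(1 − 10δ)½L = 1` one has `r₁ = κ` and the honest exponent is `5(κ + δ½Lκ)` — the located understatement of SKELETON
row B13.Eq2.39's transcript note; nothing downstream depends on the value of `b`), given the convergence of the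
majorant series (`summable_absTerm213`). [cite: Balaban1988RG2Cluster, (2.39) p.21] -/
theorem ineq239 {H : P → ℂ} {A r₁ r b c dX : ℝ} {X : Finset Cube} (hA : 0 ≤ A) (hr : 0 ≤ r₁ + r) (hc : 0 ≤ c)
    (hb : b = c * (r₁ + r)) (hd : ∀ Z, 0 ≤ d Z)
    (hH : ∀ Z, cubes Z ⊆ X → ‖H Z‖ ≤ A * Real.exp (-((r₁ + 2 * r) * d Z)))
    (h227 : Ineq227 (Finset.univ : Finset P) cubes d X dX c)
    (hsum : Summable fun n : ℕ => ((n.factorial : ℝ))⁻¹ * absTerm213 ζ (w239 d A b r) cubes n X) :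
    ‖ursellSeries213 ζ H cubes X‖ ≤
      Real.exp (-((r₁ + r) * dX)) * Real.exp (-b) * absSeries213 ζ (w239 d A b r) cubes X := by
  classical
  set pref : ℝ := Real.exp (-((r₁ + r) * dX)) * Real.exp (-b) with hpref
  have hpref0 : 0 ≤ pref := by positivity
  -- termwise domination
  have hterm : ∀ n : ℕ, ‖((n.factorial : ℂ))⁻¹ *
      ∑ Z ∈ (Finset.univ : Finset (Fin n → P)).filter
          (fun Z => (Finset.univ : Finset (Fin n)).biUnion (fun i => cubes (Z i)) = X),
        (((rhoT ζ Z : ℝ) : ℂ) * ∏ i, H (Z i))‖ ≤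
      pref * (((n.factorial : ℝ))⁻¹ * absTerm213 ζ (w239 d A b r) cubes n X) := by
    intro n
    rw [norm_mul, norm_inv, Complex.norm_natCast]
    have hS : ‖∑ Z ∈ (Finset.univ : Finset (Fin n → P)).filter
          (fun Z => (Finset.univ : Finset (Fin n)).biUnion (fun i => cubes (Z i)) = X),
        (((rhoT ζ Z : ℝ) : ℂ) * ∏ i, H (Z i))‖ ≤ pref * absTerm213 ζ (w239 d A b r) cubes n X := by
      unfold absTerm213
      rw [Finset.mul_sum]
      refine (norm_sum_le _ _).trans (Finset.sum_le_sum fun Z hZ => ?_)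
      rw [norm_mul, Complex.norm_real, Real.norm_eq_abs, Complex.norm_prod]
      have hZ' := (Finset.mem_filter.1 hZ).2
      calc |rhoT ζ Z| * ∏ i, ‖H (Z i)‖
          ≤ |rhoT ζ Z| * (pref * ∏ i, w239 d A b r (Z i)) :=
            mul_le_mul_of_nonneg_left (prod_norm_le_of_covering hA hr hc hb hd hH h227 hZ') (abs_nonneg _)
        _ = pref * (|rhoT ζ Z| * ∏ i, w239 d A b r (Z i)) := by ring
    calc ((n.factorial : ℝ))⁻¹ * ‖∑ Z ∈ (Finset.univ : Finset (Fin n → P)).filter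
            (fun Z => (Finset.univ : Finset (Fin n)).biUnion (fun i => cubes (Z i)) = X),
          (((rhoT ζ Z : ℝ) : ℂ) * ∏ i, H (Z i))‖
        ≤ ((n.factorial : ℝ))⁻¹ * (pref * absTerm213 ζ (w239 d A b r) cubes n X) :=
          mul_le_mul_of_nonneg_left hS (by positivity)
      _ = pref * (((n.factorial : ℝ))⁻¹ * absTerm213 ζ (w239 d A b r) cubes n X) := by ring
  have hsn : Summable fun n : ℕ => ‖((n.factorial : ℂ))⁻¹ *
      ∑ Z ∈ (Finset.univ : Finset (Fin n → P)).filter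
          (fun Z => (Finset.univ : Finset (Fin n)).biUnion (fun i => cubes (Z i)) = X),
        (((rhoT ζ Z : ℝ) : ℂ) * ∏ i, H (Z i))‖ :=
    Summable.of_nonneg_of_le (fun n => norm_nonneg _) hterm (hsum.mul_left pref)
  unfold ursellSeries213 absSeries213
  calc ‖∑' n : ℕ, ((n.factorial : ℂ))⁻¹ *
          ∑ Z ∈ (Finset.univ : Finset (Fin n → P)).filter
            (fun Z => (Finset.univ : Finset (Fin n)).biUnion (fun i => cubes (Z i)) = X),
          (((rhoT ζ Z : ℝ) : ℂ) * ∏ i, H (Z i))‖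
      ≤ ∑' n : ℕ, ‖((n.factorial : ℂ))⁻¹ *
          ∑ Z ∈ (Finset.univ : Finset (Fin n → P)).filter
            (fun Z => (Finset.univ : Finset (Fin n)).biUnion (fun i => cubes (Z i)) = X),
          (((rhoT ζ Z : ℝ) : ℂ) * ∏ i, H (Z i))‖ := norm_tsum_le_tsum_norm hsn
    _ ≤ ∑' n : ℕ, pref * (((n.factorial : ℝ))⁻¹ * absTerm213 ζ (w239 d A b r) cubes n X) :=
        hsn.tsum_le_tsum hterm (hsum.mul_left pref)
    _ = pref * ∑' n : ℕ, ((n.factorial : ℝ))⁻¹ * absTerm213 ζ (w239 d A b r) cubes n X := tsum_mul_left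

/-- The convergence hypothesis of `ineq239` discharged by [26]'s method (`summable_absTerm213` with the anchored norm
of the (2.39)-weights, `anchored_w239`): "κ sufficiently large" := `κ₀ + c₁ ≤ r`, "ε₁ sufficiently small" :=
`8ν A e^{b} e^{c₁} K₀ ≤ 1`. [cite: Balaban1988RG2Cluster, (2.39)–(2.40) p.21] -/
theorem summable_absTerm213_w239 (h01 : ∀ Z Z', ζ Z Z' = 0 ∨ ζ Z Z' = 1) (hsymm : ∀ Z Z', ζ Z Z' = ζ Z' Z)
    (hloc : ∀ Z Z', ζ Z' Z = 0 → ∃ q ∈ reach Z, q ∈ cubes Z')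
    (hreach : ∀ Z, ((reach Z).card : ℝ) ≤ ν * (cubes Z).card) (hν : 0 ≤ ν) (hd : ∀ Z, 0 ≤ d Z) {A b r : ℝ}
    (hA : 0 ≤ A) (hK₀ : 0 ≤ K₀)
    (h126 : Ineq126 (Finset.univ : Finset P) cubes d κ₀ K₀) (hvol : VolBound (Finset.univ : Finset P) cubes d c₁)
    (hlarge : κ₀ + c₁ ≤ r) (hsmall : 8 * ν * (A * Real.exp b * Real.exp c₁ * K₀) ≤ 1) (X : Finset Cube) :
    Summable fun n : ℕ => ((n.factorial : ℝ))⁻¹ * absTerm213 ζ (w239 d A b r) cubes n X := by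
  have hΦ : 0 ≤ A * Real.exp b * Real.exp c₁ * K₀ :=
    mul_nonneg (mul_nonneg (mul_nonneg hA (Real.exp_nonneg _)) (Real.exp_nonneg _)) hK₀
  have hanch : ∀ q : Cube, ∑ Z ∈ inside (Finset.univ : Finset P) cubes X with q ∈ cubes Z,
      w239 d A b r Z * Real.exp ((cubes Z).card : ℝ) ≤ A * Real.exp b * Real.exp c₁ * K₀ := by
    intro q
    have h := anchored_w239 (b := b) (m := 1) (inside (Finset.univ : Finset P) cubes X) hd hA zero_le_one h126 hvol
      (by simpa using hlarge) q
    simpa only [one_mul] using h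
  exact summable_absTerm213 h01 hsymm (w239_nonneg hA b r) hΦ hν hanch hloc hreach
    (by simpa [mul_assoc] using hsmall)

/-- **(2.38) ⇒ (2.41) FOR THE PRINTED SERIES (2.13), BY THE [26]-ROUTE** — the three displays chained: for a
symmetric `{0,1}`-valued footprint-local `ζ`, activities with `|H(Z)| ≤ A e^{−(r₁+2r)d_{k+1}(Z)}` on `Z ⊂ X`, (1.26)
(κ₀, K₀), (2.30) additive (c₁) including `X`, (2.27) for `X` with constant `c`,
"κ sufficiently large" := `κ₀ + 2c₁ ≤ r`, "ε₁ sufficiently small" := `8ν A e^{c(r₁+r)} e^{c₁} K₀ ≤ 1`: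
`|Σ_{n≥1} (1/n!) Σ_{∪Z_i = X} ρ^T H(Z₁)⋯H(Z_n)| ≤ 2K₀e^{3c₁} · A · exp(−r₁ d_{k+1}(X))` (= (2.41) with
`O(1) = 2K₀e^{3c₁}`; print `A = C₃ε₁`, `r₁ = (1 − 10δ)½Lκ`). [cite: Balaban1988RG2Cluster, (2.39)–(2.41) p.21] -/
theorem norm_ursellSeries213_le (h01 : ∀ Z Z', ζ Z Z' = 0 ∨ ζ Z Z' = 1) (hsymm : ∀ Z Z', ζ Z Z' = ζ Z' Z)
    (hloc : ∀ Z Z', ζ Z' Z = 0 → ∃ q ∈ reach Z, q ∈ cubes Z')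
    (hreach : ∀ Z, ((reach Z).card : ℝ) ≤ ν * (cubes Z).card) (hν : 0 ≤ ν) (hne : ∀ Z : P, (cubes Z).Nonempty)
    (hd : ∀ Z, 0 ≤ d Z) {H : P → ℂ} {A r₁ r c dX : ℝ} {X : Finset Cube} (hA : 0 ≤ A) (hK₀ : 0 ≤ K₀)
    (hκ₀ : 0 ≤ κ₀) (hc₁ : 0 ≤ c₁) (hr₁ : 0 ≤ r₁) (hc : 0 ≤ c)
    (hH : ∀ Z, cubes Z ⊆ X → ‖H Z‖ ≤ A * Real.exp (-((r₁ + 2 * r) * d Z)))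
    (h126 : Ineq126 (Finset.univ : Finset P) cubes d κ₀ K₀) (hvol : VolBound (Finset.univ : Finset P) cubes d c₁)
    (h227 : Ineq227 (Finset.univ : Finset P) cubes d X dX c) (hXvol : (X.card : ℝ) ≤ c₁ * (1 + dX)) (hdX : 0 ≤ dX)
    (hlarge : κ₀ + 2 * c₁ ≤ r)
    (hsmall : 8 * ν * (A * Real.exp (c * (r₁ + r)) * Real.exp c₁ * K₀) ≤ 1) :
    ‖ursellSeries213 ζ H cubes X‖ ≤ 2 * K₀ * Real.exp (3 * c₁) * A * Real.exp (-(r₁ * dX)) := by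
  have hlarge1 : κ₀ + c₁ ≤ r := by linarith
  have hr : 0 ≤ r₁ + r := by linarith
  have hsum := summable_absTerm213_w239 h01 hsymm hloc hreach hν hd hA hK₀ h126 hvol hlarge1 hsmall X
    (b := c * (r₁ + r))
  exact (ineq239 hA hr hc rfl hd hH h227 hsum).trans
    (ineq241_of_239 h01 hsymm hloc hreach hν hne hd hA hK₀ hκ₀ hc₁ h126 hvol hXvol hdX hlarge hsmall)

end Printed

/-! ## §5 Absolute convergence of (2.12)/(2.13) with a margin, and the Kotecký–Preiss object -/

section Margin

variable [Fintype P] [DecidableEq P] {Cube : Type*} [DecidableEq Cube]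
variable {cubes reach : P → Finset Cube} {d : P → ℝ} {ν κ₀ K₀ c₁ : ℝ}

/-- p. 20, verbatim: *"The above lemma implies that sufficient conditions for convergence of the series (2.12), (2.13)
are satisfied, see [26, 67, 25, 50]"* — BY [26]'s METHOD, quantitatively: for activities `|H(Z)| ≤ A e^{−R d(Z)}` on
the polymers `Z ⊂ X` ((2.38): `A = C₃ε₁`, `R = (1 − 8δ)½Lκ`), (1.26) and (2.30) additive, "κ sufficiently large" :=
`κ₀ + c₁ ≤ R` and "ε₁ sufficiently small" := `8ν A e^{c₁} K₀ ≤ 1`, the absolute series of (2.12) over the polymers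
inside `X` converges WITH THE MARGIN `3/2` — the hypothesis under which the gen-1 Mayer identity
`B13UrsellKPSeries.ursellSeries213_eq_locE` identifies the printed (2.13) with the tree's Kotecký–Preiss object
`B13Resummation.locE`. [cite: Balaban1988RG2Cluster, (2.39)–(2.40) p.21] -/
theorem summable_ursellAbsTermIn_of_small (h01 : ∀ Z Z', ζ Z Z' = 0 ∨ ζ Z Z' = 1)
    (hsymm : ∀ Z Z', ζ Z Z' = ζ Z' Z) (hloc : ∀ Z Z', ζ Z' Z = 0 → ∃ q ∈ reach Z, q ∈ cubes Z')
    (hreach : ∀ Z, ((reach Z).card : ℝ) ≤ ν * (cubes Z).card) (hν : 0 ≤ ν) (hd : ∀ Z, 0 ≤ d Z) {H : P → ℂ}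
    {A R : ℝ} {X : Finset Cube} (hA : 0 ≤ A) (hK₀ : 0 ≤ K₀)
    (hH : ∀ Z, cubes Z ⊆ X → ‖H Z‖ ≤ A * Real.exp (-(R * d Z)))
    (h126 : Ineq126 (Finset.univ : Finset P) cubes d κ₀ K₀) (hvol : VolBound (Finset.univ : Finset P) cubes d c₁)
    (hlarge : κ₀ + c₁ ≤ R) (hsmall : 8 * ν * (A * Real.exp c₁ * K₀) ≤ 1) :
    Summable fun n : ℕ => ursellAbsTermIn ζ H (n + 1) (inside (Finset.univ : Finset P) cubes X) *
      (3 / 2 : ℝ) ^ n / n.factorial := by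
  set B : Finset P := inside (Finset.univ : Finset P) cubes X with hB
  set Φ : ℝ := A * Real.exp c₁ * K₀ with hΦdef
  have hΦ : 0 ≤ Φ := mul_nonneg (mul_nonneg hA (Real.exp_nonneg _)) hK₀
  set Rsum : ℝ := ∑ Z ∈ B, ‖H Z‖ * Real.exp ((cubes Z).card : ℝ) with hRsum
  -- the anchored exponential norm of the activities inside `X`
  have hanch : ∀ q : Cube, ∑ Z ∈ B with q ∈ cubes Z, ‖H Z‖ * Real.exp ((cubes Z).card : ℝ) ≤ Φ := by
    intro q
    have h := anchored_w239 (cubes := cubes) (b := 0) (m := 1) (r := R) B hd hA zero_le_one h126 hvol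
      (by simpa using hlarge) q
    simp only [one_mul, Real.exp_zero, mul_one] at h
    refine le_trans (Finset.sum_le_sum fun Z hZ => ?_) h
    have hZX : cubes Z ⊆ X := (mem_inside.1 (Finset.mem_filter.1 hZ).1).2
    have hw : ‖H Z‖ ≤ w239 d A 0 R Z := by
      have := hH Z hZX
      simpa [w239] using this
    exact mul_le_mul_of_nonneg_right hw (Real.exp_nonneg _)
  -- the order-(n+1) absolute term over `B` is the full `piFinset` sum
  have hset : ∀ n : ℕ, (Finset.univ : Finset (Fin (n + 1) → P)).filter (fun Z => ∀ i, Z i ∈ B) =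
      Fintype.piFinset fun _ : Fin (n + 1) => B := fun n => by
    ext Z; simp [Fintype.mem_piFinset]
  have hterm : ∀ n : ℕ, ursellAbsTermIn ζ H (n + 1) B * (3 / 2 : ℝ) ^ n / n.factorial ≤
      Rsum * (4 * (ν * Φ) * (3 / 2)) ^ n := by
    intro n
    have h := sum_inside_succ_div_le (cubes := cubes) (X := X) h01 hsymm (w := fun Z => ‖H Z‖)
      (fun Z => norm_nonneg _) hΦ hν hanch hloc hreach n
    have heq : ursellAbsTermIn ζ H (n + 1) B * (3 / 2 : ℝ) ^ n / n.factorial =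
        (((n.factorial : ℝ))⁻¹ * ∑ Z ∈ Fintype.piFinset (fun _ : Fin (n + 1) => B),
          |rhoT ζ Z| * ∏ i, ‖H (Z i)‖) * (3 / 2 : ℝ) ^ n := by
      unfold ursellAbsTermIn
      rw [hset n]
      ring
    rw [heq, mul_pow]
    calc (((n.factorial : ℝ))⁻¹ * ∑ Z ∈ Fintype.piFinset (fun _ : Fin (n + 1) => B),
          |rhoT ζ Z| * ∏ i, ‖H (Z i)‖) * (3 / 2 : ℝ) ^ n
        ≤ (Rsum * (4 * (ν * Φ)) ^ n) * (3 / 2 : ℝ) ^ n := mul_le_mul_of_nonneg_right h (by positivity)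
      _ = Rsum * ((4 * (ν * Φ)) ^ n * (3 / 2 : ℝ) ^ n) := by ring
  have hRsum0 : 0 ≤ Rsum := Finset.sum_nonneg fun Z _ => mul_nonneg (norm_nonneg _) (Real.exp_nonneg _)
  have hθ0 : 0 ≤ 4 * (ν * Φ) * (3 / 2) := by positivity
  have hθ1 : 4 * (ν * Φ) * (3 / 2) < 1 := by
    have : 8 * (ν * Φ) ≤ 1 := by simpa [hΦdef, mul_assoc] using hsmall
    linarith
  refine Summable.of_nonneg_of_le (fun n => ?_) hterm (Summable.mul_left _ (summable_geometric_of_lt_one hθ0 hθ1))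
  exact div_nonneg (mul_nonneg (B13UrsellKPSeries.ursellAbsTermIn_nonneg _ _ _ _) (by positivity))
    (Nat.cast_nonneg _)

/-- **THE PRINTED (2.13) IS THE TREE'S KOTECKÝ–PREISS OBJECT, under the smallness of [26]'s route**: for the
incompatibility `ι` of (2.11) (`ζ = zetaOf ι`), activities `|H(Z)| ≤ A e^{−R d(Z)}` on `Z ⊂ X`, (1.26), (2.30)
additive, footprint locality, `κ₀ + c₁ ≤ R` and `8ν A e^{c₁} K₀ ≤ 1`:
`Σ_{n≥1} (1/n!) Σ_{∪Z_i = X} ρ^T H(Z₁)⋯H(Z_n) = Σ_{C: ∪C = X} Φ^T(C)` (`B13Resummation.locE`) — the gen-1 Mayer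
identity with its convergence hypothesis DISCHARGED by `summable_ursellAbsTermIn_of_small`.
[cite: Balaban1988RG2Cluster, (2.13) p.14] -/
theorem ursellSeries213_eq_locE_of_small (ι : P → P → Prop) [DecidableRel ι] [Std.Refl ι] [Std.Symm ι]
    (hloc : ∀ Z Z', ι Z' Z → ∃ q ∈ reach Z, q ∈ cubes Z')
    (hreach : ∀ Z, ((reach Z).card : ℝ) ≤ ν * (cubes Z).card) (hν : 0 ≤ ν) (hd : ∀ Z, 0 ≤ d Z) {H : P → ℂ}
    {A R : ℝ} {X : Finset Cube} (hA : 0 ≤ A) (hK₀ : 0 ≤ K₀)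
    (hH : ∀ Z, cubes Z ⊆ X → ‖H Z‖ ≤ A * Real.exp (-(R * d Z)))
    (h126 : Ineq126 (Finset.univ : Finset P) cubes d κ₀ K₀) (hvol : VolBound (Finset.univ : Finset P) cubes d c₁)
    (hlarge : κ₀ + c₁ ≤ R) (hsmall : 8 * ν * (A * Real.exp c₁ * K₀) ≤ 1) :
    ursellSeries213 (zetaOf ι) H cubes X = B13Resummation.locE ι cubes H X :=
  ursellSeries213_eq_locE H cubes X (by norm_num : (1 : ℝ) < 3 / 2)
    (summable_ursellAbsTermIn_of_small (zetaOf_01 (ι := ι)) zetaOf_symm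
      (fun Z Z' h => hloc Z Z' (zetaOf_eq_zero_iff.1 h)) hreach hν hd hA hK₀ hH h126 hvol hlarge hsmall)

end Margin

end Literature.MathematicalPhysics.QuantumFieldTheory.Balaban1983to89.B13Eq240Printed

/-! ## §6 The bridge to `B13.lean`: the [26]-route discharge of `B13.CammarotaStepWith` -/

namespace Literature.MathematicalPhysics.QuantumFieldTheory.Balaban1983to89.B13Eq240Printed

open Literature.MathematicalPhysics.QuantumFieldTheory.Balaban1983to89.B13 (CammarotaStepWith CammarotaStep
  Bound238With)
open Literature.MathematicalPhysics.QuantumFieldTheory.Balaban1983to89.B13Resummation (Geometry SpRestr Repr213 locE)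
open Literature.MathematicalPhysics.QuantumFieldTheory.Balaban1983to89.B13MayerDecoupling (ursellSeries213)
open Literature.MathematicalPhysics.QuantumFieldTheory.Balaban1983to89.B13UrsellKPSeries (zetaOf zetaOf_01 zetaOf_symm
  zetaOf_eq_zero_iff)

open Classical in
/-- **THE CORE ESTIMATE ON THE ABSTRACT STEP DATA**: given the polymer geometry of 𝐃_{k+1} (`B13Resummation.Geometry`:
footprints, the incompatibility of (2.11) with its locality `reach`/`ν`, (1.26) at scale `k + 1` (κ₀, K₀), (2.30)
additive (c₁), (2.27) with the printed `5`), the restriction property of the spaces (p. 15, `SpRestr`) and Lemma 3's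
bound (2.38)_ℓ, the PRINTED series (2.13) of the activities `Z ↦ H(Z, φ)` obeys (2.41)_ℓ:
`|Σ_n (1/n!) Σ_{∪Z_i = X} ρ^T Π H(Z_i, φ)| ≤ A₂ C₃ε₁ exp(−(1 − 10δ)ℓκ d_{k+1}(X))` on `Uᶜ_{k+1}(X)`, by [26, §3], as
soon as "κ sufficiently large" := `κ₀ + 2c₁ ≤ δℓκ`, "ε₁ sufficiently small" := `8ν · C₃ε₁ e^{5(1−9δ)ℓκ} e^{c₁} K₀ ≤ 1`
(merging exponent `5(1 − 9δ)ℓκ` for the extraction of `(1 − 9δ)ℓκ` through (2.27); print *"exp 5κ"*) and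
`A₂ ≥ 2K₀e^{3c₁}`. [cite: Balaban1988RG2Cluster, (2.39)–(2.41) p.21] -/
theorem norm_ursellSeries213_le_step (S : B13.StepData) (c : B13.Consts) (ℓ : ℝ) {Cube : Type} [DecidableEq Cube]
    (G : Geometry S.Dk1 Cube) (hsp : SpRestr S G) (h238 : Bound238With S c ℓ)
    (hA : 0 ≤ c.C3act * c.ε₁) (hr₁ : 0 ≤ (1 - 10 * c.δ) * ℓ * c.κ)
    (hlarge : G.κ₀ + 2 * G.c₁ ≤ c.δ * ℓ * c.κ)
    (hsmall : 8 * G.ν * (c.C3act * c.ε₁ * Real.exp (5 * ((1 - 9 * c.δ) * ℓ * c.κ)) * Real.exp G.c₁ * G.K₀) ≤ 1)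
    (hA₂ : 2 * G.K₀ * Real.exp (3 * G.c₁) ≤ c.A₂) {X : S.Dk1.Dom} {φ : S.Φ} (hφ : φ ∈ S.sp2 X) :
    ‖ursellSeries213 (zetaOf G.ι) (fun Z => S.H Z φ) G.cubes (G.cubes X)‖ ≤
      c.A₂ * c.C3act * c.ε₁ * Real.exp (-((1 - 10 * c.δ) * ℓ * c.κ * S.Dk1.dj X)) := by
  haveI : Std.Symm G.ι := ⟨G.ι_symm⟩
  -- the activity bound (2.38)_ℓ on the polymers inside `X`, rates `(1 − 8δ)ℓκ = r₁ + 2r`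
  have hH : ∀ Z, G.cubes Z ⊆ G.cubes X → ‖S.H Z φ‖ ≤ c.C3act * c.ε₁ *
      Real.exp (-(((1 - 10 * c.δ) * ℓ * c.κ + 2 * (c.δ * ℓ * c.κ)) * S.Dk1.dj Z)) := by
    intro Z hZ
    have h := h238 Z φ (hsp X Z φ hZ hφ)
    have hrate : (1 - 8 * c.δ) * ℓ * c.κ * S.Dk1.dj Z =
        ((1 - 10 * c.δ) * ℓ * c.κ + 2 * (c.δ * ℓ * c.κ)) * S.Dk1.dj Z := by ring
    rwa [hrate] at h
  have hb : 5 * ((1 - 10 * c.δ) * ℓ * c.κ + c.δ * ℓ * c.κ) = 5 * ((1 - 9 * c.δ) * ℓ * c.κ) := by ring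
  have hsmall' : 8 * G.ν * (c.C3act * c.ε₁ * Real.exp (5 * ((1 - 10 * c.δ) * ℓ * c.κ + c.δ * ℓ * c.κ)) *
      Real.exp G.c₁ * G.K₀) ≤ 1 := by rw [hb]; exact hsmall
  have hXvol : ((G.cubes X).card : ℝ) ≤ G.c₁ * (1 + S.Dk1.dj X) := G.volBound X (Finset.mem_univ X)
  have h := norm_ursellSeries213_le (ζ := zetaOf G.ι) (cubes := G.cubes) (reach := G.reach) (d := S.Dk1.dj)
    (zetaOf_01 (ι := G.ι)) zetaOf_symm (fun Z Z' h0 => G.loc Z Z' (zetaOf_eq_zero_iff.1 h0)) G.reach_le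
    G.ν_nonneg G.cubes_nonempty S.Dk1.dj_nonneg hA G.K₀_nonneg G.κ₀_nonneg G.c₁_nonneg hr₁
    (by norm_num : (0 : ℝ) ≤ 5) hH G.ineq126 G.volBound (G.ineq227 X) hXvol (S.Dk1.dj_nonneg X) hlarge hsmall'
  have hE : 0 ≤ c.C3act * c.ε₁ * Real.exp (-((1 - 10 * c.δ) * ℓ * c.κ * S.Dk1.dj X)) :=
    mul_nonneg hA (Real.exp_nonneg _)
  calc ‖ursellSeries213 (zetaOf G.ι) (fun Z => S.H Z φ) G.cubes (G.cubes X)‖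
      ≤ 2 * G.K₀ * Real.exp (3 * G.c₁) * (c.C3act * c.ε₁) *
          Real.exp (-((1 - 10 * c.δ) * ℓ * c.κ * S.Dk1.dj X)) := by simpa [mul_assoc] using h
    _ = 2 * G.K₀ * Real.exp (3 * G.c₁) *
          (c.C3act * c.ε₁ * Real.exp (-((1 - 10 * c.δ) * ℓ * c.κ * S.Dk1.dj X))) := by ring
    _ ≤ c.A₂ * (c.C3act * c.ε₁ * Real.exp (-((1 - 10 * c.δ) * ℓ * c.κ * S.Dk1.dj X))) :=
        mul_le_mul_of_nonneg_right hA₂ hE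
    _ = c.A₂ * c.C3act * c.ε₁ * Real.exp (-((1 - 10 * c.δ) * ℓ * c.κ * S.Dk1.dj X)) := by ring

open Classical in
/-- **G-B13-11 BY THE PRINTED ROUTE [26]** (general transfer factor ℓ): with the PRINTED representation (2.13) of
`E^{(k+1)}(X)` as the Ursell series (`B13MayerDecoupling.ursellSeries213` of the activities `Z ↦ H(Z, ·)`,
`ζ = zetaOf ι`) the step (2.38)_ℓ ⇒ (2.41)_ℓ = `B13.CammarotaStepWith S c ℓ` HOLDS under the largeness/smallness of
`norm_ursellSeries213_le_step`.  Twin of the Kotecký–Preiss discharge `B13Resummation.cammarotaStepWith_of_KP` (which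
needs no `|X|`, hence only the `κ₀`-largeness `2δℓκ ≥ 2κ₀ + 2`). [cite: Balaban1988RG2Cluster, (2.39)–(2.41) p.21] -/
theorem cammarotaStepWith_of_treeGraph (S : B13.StepData) (c : B13.Consts) (ℓ : ℝ) {Cube : Type} [DecidableEq Cube]
    (G : Geometry S.Dk1 Cube) (hsp : SpRestr S G)
    (hrep : ∀ X φ, φ ∈ S.sp2 X →
      S.Ek1 X φ = ursellSeries213 (zetaOf G.ι) (fun Z => S.H Z φ) G.cubes (G.cubes X))
    (hA : 0 ≤ c.C3act * c.ε₁) (hr₁ : 0 ≤ (1 - 10 * c.δ) * ℓ * c.κ)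
    (hlarge : G.κ₀ + 2 * G.c₁ ≤ c.δ * ℓ * c.κ)
    (hsmall : 8 * G.ν * (c.C3act * c.ε₁ * Real.exp (5 * ((1 - 9 * c.δ) * ℓ * c.κ)) * Real.exp G.c₁ * G.K₀) ≤ 1)
    (hA₂ : 2 * G.K₀ * Real.exp (3 * G.c₁) ≤ c.A₂) :
    CammarotaStepWith S c ℓ := by
  intro h238 X φ hφ
  rw [hrep X φ hφ]
  exact norm_ursellSeries213_le_step S c ℓ G hsp h238 hA hr₁ hlarge hsmall hA₂ hφ

open Classical in
/-- The same at the printed transfer factor ℓ = ½L: `B13.CammarotaStep S c` = (2.38) ⇒ (2.41) AS PRINTED, by the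
[26]-route. [cite: Balaban1988RG2Cluster, (2.39)–(2.41) p.21] -/
theorem cammarotaStep_of_treeGraph (S : B13.StepData) (c : B13.Consts) {Cube : Type} [DecidableEq Cube]
    (G : Geometry S.Dk1 Cube) (hsp : SpRestr S G)
    (hrep : ∀ X φ, φ ∈ S.sp2 X →
      S.Ek1 X φ = ursellSeries213 (zetaOf G.ι) (fun Z => S.H Z φ) G.cubes (G.cubes X))
    (hA : 0 ≤ c.C3act * c.ε₁) (hr₁ : 0 ≤ (1 - 10 * c.δ) * ((c.L : ℝ) / 2) * c.κ)
    (hlarge : G.κ₀ + 2 * G.c₁ ≤ c.δ * ((c.L : ℝ) / 2) * c.κ)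
    (hsmall : 8 * G.ν * (c.C3act * c.ε₁ * Real.exp (5 * ((1 - 9 * c.δ) * ((c.L : ℝ) / 2) * c.κ)) *
      Real.exp G.c₁ * G.K₀) ≤ 1)
    (hA₂ : 2 * G.K₀ * Real.exp (3 * G.c₁) ≤ c.A₂) :
    CammarotaStep S c :=
  cammarotaStepWith_of_treeGraph S c ((c.L : ℝ) / 2) G hsp hrep hA hr₁ hlarge hsmall hA₂

open Classical in
/-- **G-B13-11 BY THE PRINTED ROUTE, FROM THE KOTECKÝ–PREISS REPRESENTATION** (`B13Resummation.Repr213`: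
`E^{(k+1)}(X) = locE`): under (2.38)_ℓ and the same largeness/smallness the printed series (2.13) converges absolutely
with a margin and EQUALS `locE` (`ursellSeries213_eq_locE_of_small`), so the [26]-route bound applies to the tree's
object of record — a second, independent kernel discharge of the by-reference step next to
`B13Resummation.cammarotaStepWith_of_KP`. [cite: Balaban1988RG2Cluster, (2.39)–(2.41) p.21] -/
theorem cammarotaStepWith_of_treeGraph_locE (S : B13.StepData) (c : B13.Consts) (ℓ : ℝ) {Cube : Type} [DecidableEq Cube]
    (G : Geometry S.Dk1 Cube) (hsp : SpRestr S G) (hrep : Repr213 S G)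
    (hA : 0 ≤ c.C3act * c.ε₁) (hr₁ : 0 ≤ (1 - 10 * c.δ) * ℓ * c.κ)
    (hlarge : G.κ₀ + 2 * G.c₁ ≤ c.δ * ℓ * c.κ)
    (hsmall : 8 * G.ν * (c.C3act * c.ε₁ * Real.exp (5 * ((1 - 9 * c.δ) * ℓ * c.κ)) * Real.exp G.c₁ * G.K₀) ≤ 1)
    (hA₂ : 2 * G.K₀ * Real.exp (3 * G.c₁) ≤ c.A₂) :
    CammarotaStepWith S c ℓ := by
  intro h238 X φ hφ
  haveI : Std.Refl G.ι := ⟨G.ι_refl⟩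
  haveI : Std.Symm G.ι := ⟨G.ι_symm⟩
  have hH : ∀ Z, G.cubes Z ⊆ G.cubes X → ‖S.H Z φ‖ ≤
      c.C3act * c.ε₁ * Real.exp (-((1 - 8 * c.δ) * ℓ * c.κ * S.Dk1.dj Z)) :=
    fun Z hZ => h238 Z φ (hsp X Z φ hZ hφ)
  have hδ : 0 ≤ c.δ * ℓ * c.κ := by linarith [G.κ₀_nonneg, G.c₁_nonneg]
  have hlarge' : G.κ₀ + G.c₁ ≤ (1 - 8 * c.δ) * ℓ * c.κ := by nlinarith [G.c₁_nonneg]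
  have hsmall' : 8 * G.ν * (c.C3act * c.ε₁ * Real.exp G.c₁ * G.K₀) ≤ 1 := by
    refine le_trans ?_ hsmall
    have h1 : (1 : ℝ) ≤ Real.exp (5 * ((1 - 9 * c.δ) * ℓ * c.κ)) := Real.one_le_exp (by nlinarith)
    have h2 : 0 ≤ 8 * G.ν * (c.C3act * c.ε₁) * Real.exp G.c₁ * G.K₀ := by
      have := G.ν_nonneg; have := G.K₀_nonneg; positivity
    calc 8 * G.ν * (c.C3act * c.ε₁ * Real.exp G.c₁ * G.K₀)
        = (8 * G.ν * (c.C3act * c.ε₁) * Real.exp G.c₁ * G.K₀) * 1 := by ring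
      _ ≤ (8 * G.ν * (c.C3act * c.ε₁) * Real.exp G.c₁ * G.K₀) * Real.exp (5 * ((1 - 9 * c.δ) * ℓ * c.κ)) :=
          mul_le_mul_of_nonneg_left h1 h2
      _ = 8 * G.ν * (c.C3act * c.ε₁ * Real.exp (5 * ((1 - 9 * c.δ) * ℓ * c.κ)) * Real.exp G.c₁ * G.K₀) := by ring
  rw [hrep X φ hφ, ← ursellSeries213_eq_locE_of_small G.ι (cubes := G.cubes) (reach := G.reach) (d := S.Dk1.dj)
    G.loc G.reach_le G.ν_nonneg S.Dk1.dj_nonneg hA G.K₀_nonneg hH G.ineq126 G.volBound hlarge' hsmall']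
  exact norm_ursellSeries213_le_step S c ℓ G hsp h238 hA hr₁ hlarge hsmall hA₂ hφ

/-! ## §7 (v1.1) The [26]-route under the closing condition `(1 − 10δ)ℓ = 1`, and the §2 chain of `B13.lean` -/

open Literature.MathematicalPhysics.QuantumFieldTheory.Balaban1983to89.B13 (Bound118 Deliverables Lemma3With
  bound118_of_bound241With deliverables_of_chainWith)

open Classical in
/-- `cammarotaStepWith_of_treeGraph_locE` in the printed letters, under the closing condition `(1 − 10δ)ℓ = 1` of p. 21
(*"At first we assume that (1 − 10δ)½L = 1"*; `B13.Consts.R22gen`, printed ℓ = ½L): then `(1 − 10δ)ℓκ = κ` and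
`(1 − 9δ)ℓκ = κ + δℓκ`, so "κ sufficiently large" reads `κ₀ + 2c₁ ≤ δℓκ` and "ε₁ sufficiently small" reads
`8ν C₃ε₁ e^{5(κ + δℓκ)} e^{c₁} K₀ ≤ 1` — the honest form of the printed activity-with-merging-cost *"C₃ε₁ exp 5κ"* of
(2.39)/(2.40) along the [26]-route (the Kotecký–Preiss twin `B13Resummation.cammarotaStepWith_of_KP_R22gen` needs
`κ + 2κ₀ + 2 ≤ (1 − 8δ)ℓκ` and `C₃ε₁ e^{5κ+1} K₀νc₁ ≤ 1`). [cite: Balaban1988RG2Cluster, (2.39)–(2.41) p.21] -/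
theorem cammarotaStepWith_of_treeGraph_R22gen (S : B13.StepData) (c : B13.Consts) {ℓ : ℝ} {Cube : Type}
    [DecidableEq Cube] (G : Geometry S.Dk1 Cube) (hsp : SpRestr S G) (hrep : Repr213 S G) (h22 : c.R22gen ℓ)
    (hA : 0 ≤ c.C3act * c.ε₁) (hκ : 0 ≤ c.κ) (hlarge : G.κ₀ + 2 * G.c₁ ≤ c.δ * ℓ * c.κ)
    (hsmall : 8 * G.ν * (c.C3act * c.ε₁ * Real.exp (5 * (c.κ + c.δ * ℓ * c.κ)) * Real.exp G.c₁ * G.K₀) ≤ 1)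
    (hA₂ : 2 * G.K₀ * Real.exp (3 * G.c₁) ≤ c.A₂) :
    CammarotaStepWith S c ℓ := by
  have h1 : (1 - 10 * c.δ) * ℓ = 1 := h22
  have hr₁ : (1 - 10 * c.δ) * ℓ * c.κ = c.κ := by rw [h1, one_mul]
  have h9 : (1 - 9 * c.δ) * ℓ * c.κ = c.κ + c.δ * ℓ * c.κ := by
    have : (1 - 9 * c.δ) * ℓ * c.κ = (1 - 10 * c.δ) * ℓ * c.κ + c.δ * ℓ * c.κ := by ring
    rw [this, hr₁]
  refine cammarotaStepWith_of_treeGraph_locE S c ℓ G hsp hrep hA ?_ hlarge ?_ hA₂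
  · rw [hr₁]; exact hκ
  · rw [h9]; exact hsmall

open Classical in
/-- p. 21 [21], verbatim: *"The inequality (2.41) and the assumptions imply the inequality (I.1.18), with ½E₀ instead of
E₀, for the terms of the effective action E^{(k+1)} in (I.1.3)."* — now from (2.38)_ℓ itself ALONG THE PRINTED ROUTE:
Lemma 3's bound + the polymer geometry + (2.13) + `(1 − 10δ)ℓ = 1` + `O(1)C₃ε₁ ≤ ½E₀` + the explicit largeness/smallness
of the [26]-route ⇒ `|E^{(k+1)}(X)| ≤ ½E₀ exp(−κ d_{k+1}(X))` (`B13.bound118_of_bound241With` ∘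
`cammarotaStepWith_of_treeGraph_R22gen`; KP twin `B13Resummation.bound118_of_KP`).
[cite: Balaban1988RG2Cluster, p.21 (after (2.41))] -/
theorem bound118_of_treeGraph (S : B13.StepData) (c : B13.Consts) {ℓ : ℝ} {Cube : Type} [DecidableEq Cube]
    (G : Geometry S.Dk1 Cube) (hsp : SpRestr S G) (hrep : Repr213 S G) (h238 : Bound238With S c ℓ)
    (h22 : c.R22gen ℓ) (h23 : c.R23) (hA : 0 ≤ c.C3act * c.ε₁) (hκ : 0 ≤ c.κ)
    (hlarge : G.κ₀ + 2 * G.c₁ ≤ c.δ * ℓ * c.κ)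
    (hsmall : 8 * G.ν * (c.C3act * c.ε₁ * Real.exp (5 * (c.κ + c.δ * ℓ * c.κ)) * Real.exp G.c₁ * G.K₀) ≤ 1)
    (hA₂ : 2 * G.K₀ * Real.exp (3 * G.c₁) ≤ c.A₂) :
    Bound118 S.Dk1 S.sp2 S.Ek1 (c.E₀ / 2) c.κ :=
  bound118_of_bound241With S c
    (cammarotaStepWith_of_treeGraph_R22gen S c G hsp hrep h22 hA hκ hlarge hsmall hA₂ h238) h22 h23

open Classical in
/-- The §2 chain of `B13.deliverables_of_chainWith` (pp. 20–22: restrictions + Lemma 3_ℓ + the [26]-step_ℓ +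
`(1 − 10δ)ℓ = 1` + `O(1)C₃ε₁ ≤ ½E₀` + the log Z^{(k)} half with `δ₀M ≥ κ` + analyticity, gauge invariance, (I.1.7) ⇒ the
delivered clauses for A_{k+1}) with the hypothesis `CammarotaStepWith S c ℓ` REPLACED by its discharge ALONG THE PRINTED
ROUTE [26] (tree-graph inequality + Cayley; KP twin `B13Resummation.deliverables_of_chainWith_KP`).
[cite: Balaban1988RG2Cluster, pp.20–22 (Lemma 3 to Thm I.3)] -/
theorem deliverables_of_chainWith_treeGraph (S : B13.StepData) (c : B13.Consts) {ℓ : ℝ} {Cube : Type}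
    [DecidableEq Cube] (G : Geometry S.Dk1 Cube) (hsp : SpRestr S G) (hrep : Repr213 S G)
    (hA : 0 ≤ c.C3act * c.ε₁) (hκ : 0 ≤ c.κ) (hlarge : G.κ₀ + 2 * G.c₁ ≤ c.δ * ℓ * c.κ)
    (hsmall : 8 * G.ν * (c.C3act * c.ε₁ * Real.exp (5 * (c.κ + c.δ * ℓ * c.κ)) * Real.exp G.c₁ * G.K₀) ≤ 1)
    (hA₂ : 2 * G.K₀ * Real.exp (3 * G.c₁) ≤ c.A₂)
    (hR : S.Restr) (h3 : Lemma3With S c ℓ) (h22 : c.R22gen ℓ) (h23 : c.R23) (h24 : c.R24) (hE₀ : 0 ≤ c.E₀)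
    (hlog : Bound118 S.Dk1 S.sp2 S.Elog (c.E₀ / 2) (c.δ₀ * c.M)) (hrepr : S.Repr17)
    (han : ∀ X, S.Analytic (S.Etot X) (S.sp2 X)) (hg : ∀ X, S.GaugeInv (S.Etot X)) :
    Deliverables S c :=
  deliverables_of_chainWith S c hR h3
    (cammarotaStepWith_of_treeGraph_R22gen S c G hsp hrep h22 hA hκ hlarge hsmall hA₂) h22 h23 h24 hE₀ hlog hrepr
    han hg

end Literature.MathematicalPhysics.QuantumFieldTheory.Balaban1983to89.B13Eq240Printed
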